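import Summits.Ventures.Crystal3D.Bulk.GapVertexStar
import HarnessLib

/-!
# The rhombus row R-rhomb: a tight 4-cycle of shell balls is a symmetric spherical rhombus —
# `(1 + ⟪u_a, u_c⟫)(1 + ⟪u_b, u_d⟫) = 1`, opposite corners equal (MT12 Prop. 3.8 at `d = 60°`)

HONEST FRAMING. Part of the venture `Summits/Ventures/Crystal3D` (cell `pub-crystal3d`, phase 2,
24-hour sprint `PLAN.md` R42/R43; seat typer-bulk-2). The census LP's row R-rhomb
(`phase2/ENV-CENSUS/DESIGN-L12-THEORY.md` §P-L4 C: "x-rhombus: opposite corners equal,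
`cot(u₁/2)·cot(u₂/2) = 1/2` [MT12 Prop 3.8, `d = 60°` EXACT]; diagonal
`cos d₁₃ = 1/4 + (3/4) cos u₂`") concerns four shell balls `a, b, c, d` of an admissible
configuration with the four contacts `ab, bc, cd, da` (directions pairwise at `60°` around the
cycle). THIS file proves, for EVERY admissible configuration and every such tight 4-cycle with
`a ≠ c`, `b ≠ d` (face or not — no face theory is needed):

* `IsGapConfig.cos_corner_rhombus`: `cos (corner c a b d) = (4⟪u_b, u_d⟫ − 1)/3` — the
  diagonal/corner relation "`cos d₁₃ = 1/4 + (3/4) cos u`" (`u_x = gapDir c x`);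
* **`IsGapConfig.corner_eq_corner_opposite`**: opposite corners of the rhombus are equal,
  `corner c a b d = corner c c b d`;
* **`IsGapConfig.rhombus_diag_relation`**: `(1 + ⟪u_a, u_c⟫) · (1 + ⟪u_b, u_d⟫) = 1` — the
  exact closure relation of the `60°`-rhombus on `S²` between its two diagonals, and its corner
  form **`IsGapConfig.rhombus_corner_relation`**: adjacent corners satisfy
  `(1 − cos u_a)(1 − cos u_b) = 4(1 + cos u_a)(1 + cos u_b)`, i.e. `cot(u_a/2) cot(u_b/2) = 1/2`.

Method for the last: azimuths around `u_b` (`Bulk/GapVertexStar.lean`, tree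
`SphericalCodeVertexStar`): `u_a, u_c` sit at level `1/2`, `u_d` at level `y = ⟪u_b, u_d⟫`; the
contacts `ad`, `cd` force `cos(θ_a − θ_d) = cos(θ_c − θ_d)`, and `a ≠ c` forces
`θ_c − θ_d ≡ −(θ_a − θ_d) (mod 2π)`, whence `⟪u_a, u_c⟫ = 1/4 + (3/4) cos 2(θ_a − θ_d) = −y/(1+y)`.
This is where dimension three enters (two points at `60°` from both `u_b` and `u_d` are mirror
images); in `ℝ⁴` only `(1 + ⟪u_a,u_c⟫)(1 + ⟪u_b,u_d⟫) ≥ 1` would hold. Nothing is claimed about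
GAP(1.26).
-/

noncomputable section

open scoped BigOperators InnerProductSpace
open Finset Real

namespace Summit.Ventures.Crystal3D

open Literature.Geometry.DiscreteGeometry

variable {c : Fin 14 → EuclideanSpace ℝ (Fin 3)}

/-- **Diagonal/corner relation**: at a shell ball `a` touching shell balls `b` and `d`,
`cos (corner c a b d) = (4⟪u_b, u_d⟫ − 1)/3`, i.e. `⟪u_b, u_d⟫ = 1/4 + (3/4) cos u_a`. -/
theorem IsGapConfig.cos_corner_rhombus (hc : IsGapConfig c) {a b d : Fin 14} (ha0 : a ≠ 0)
    (ha13 : a ≠ 13) (hb0 : b ≠ 0) (hb13 : b ≠ 13) (hd0 : d ≠ 0) (hd13 : d ≠ 13)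
    (hab : dist (c a) (c b) = 1) (had : dist (c a) (c d) = 1) :
    Real.cos (corner c a b d) = (4 * ⟪gapDir c b, gapDir c d⟫_ℝ - 1) / 3 := by
  have h1 := hc.inner_gapDir_eq ha0 hb0 hab
  have h2 := hc.inner_gapDir_eq ha0 hd0 had
  rw [tightLevel_of_ne ha13 hb13] at h1
  rw [tightLevel_of_ne ha13 hd13] at h2
  unfold corner
  rw [InnerProductGeometry.cos_angle,
    norm_tangentProj_eq_sqrt (hc.norm_gapDir ha0) (hc.norm_gapDir hb0) h1,
    norm_tangentProj_eq_sqrt (hc.norm_gapDir ha0) (hc.norm_gapDir hd0) h2,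
    inner_tangentProj_eq_twoLevel (hc.norm_gapDir ha0) h1 h2 rfl, sqrt_one_sub_half_sq]
  have hs : (√3 / 2 * (√3 / 2) : ℝ) = 3 / 4 := by
    rw [div_mul_div_comm, Real.mul_self_sqrt (by norm_num)]; norm_num
  rw [hs]
  field_simp
  ring

/-- **Opposite corners of a tight rhombus are equal**: if the shell balls `a` and `e` both
touch the shell balls `b` and `d`, then `corner c a b d = corner c e b d` (both are the
`arccos` of `(4⟪u_b, u_d⟫ − 1)/3`). -/
theorem IsGapConfig.corner_eq_corner_opposite (hc : IsGapConfig c) {a e b d : Fin 14}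
    (ha0 : a ≠ 0) (ha13 : a ≠ 13) (he0 : e ≠ 0) (he13 : e ≠ 13) (hb0 : b ≠ 0) (hb13 : b ≠ 13)
    (hd0 : d ≠ 0) (hd13 : d ≠ 13) (hab : dist (c a) (c b) = 1) (had : dist (c a) (c d) = 1)
    (heb : dist (c e) (c b) = 1) (hed : dist (c e) (c d) = 1) :
    corner c a b d = corner c e b d := by
  have h1 := hc.cos_corner_rhombus ha0 ha13 hb0 hb13 hd0 hd13 hab had
  have h2 := hc.cos_corner_rhombus he0 he13 hb0 hb13 hd0 hd13 heb hed
  have ha := InnerProductGeometry.angle_nonneg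
    (tangentProj (gapDir c a) (gapDir c b)) (tangentProj (gapDir c a) (gapDir c d))
  have ha' := InnerProductGeometry.angle_le_pi
    (tangentProj (gapDir c a) (gapDir c b)) (tangentProj (gapDir c a) (gapDir c d))
  have he := InnerProductGeometry.angle_nonneg
    (tangentProj (gapDir c e) (gapDir c b)) (tangentProj (gapDir c e) (gapDir c d))
  have he' := InnerProductGeometry.angle_le_pi
    (tangentProj (gapDir c e) (gapDir c b)) (tangentProj (gapDir c e) (gapDir c d))
  unfold corner at h1 h2 ⊢
  exact Real.injOn_cos ⟨ha, ha'⟩ ⟨he, he'⟩ (h1.trans h2.symm)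

/-- An integer strictly between `−1` and `1` is `0` (real-cast form). -/
theorem int_eq_zero_of_abs_lt_one {m : ℤ} (h1 : (m : ℝ) < 1) (h2 : (-1 : ℝ) < m) : m = 0 := by
  have h1' : m < 1 := by exact_mod_cast h1
  have h2' : -1 < m := by exact_mod_cast h2
  omega

/-- **The rhombus closure relation (R-rhomb, MT12 Prop. 3.8 at `d = 60°`).** For an admissible
configuration and four shell balls `a, b, e, d` with contacts `ab, be, ed, da`, `a ≠ e`,
`b ≠ d`: the two diagonals satisfy `(1 + ⟪u_a, u_e⟫) · (1 + ⟪u_b, u_d⟫) = 1`. -/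
theorem IsGapConfig.rhombus_diag_relation (hc : IsGapConfig c) (hD : intruderDist c < 2)
    {a b e d : Fin 14} (ha0 : a ≠ 0) (ha13 : a ≠ 13) (hb0 : b ≠ 0) (hb13 : b ≠ 13)
    (he0 : e ≠ 0) (he13 : e ≠ 13) (hd0 : d ≠ 0) (hd13 : d ≠ 13) (hae : a ≠ e) (hbd : b ≠ d)
    (hab : dist (c a) (c b) = 1) (hbe : dist (c b) (c e) = 1) (hed : dist (c e) (c d) = 1)
    (hda : dist (c d) (c a) = 1) :
    (1 + ⟪gapDir c a, gapDir c e⟫_ℝ) * (1 + ⟪gapDir c b, gapDir c d⟫_ℝ) = 1 := by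
  -- levels around `v = u_b`
  have hba : ⟪gapDir c b, gapDir c a⟫_ℝ = 1 / 2 := by
    rw [real_inner_comm]
    have := hc.inner_gapDir_eq ha0 hb0 hab; rwa [tightLevel_of_ne ha13 hb13] at this
  have hbe' : ⟪gapDir c b, gapDir c e⟫_ℝ = 1 / 2 := by
    have := hc.inner_gapDir_eq hb0 he0 hbe; rwa [tightLevel_of_ne hb13 he13] at this
  set y := ⟪gapDir c b, gapDir c d⟫_ℝ with hy
  -- the contacts `ad`, `ed` in two-level azimuth form around `u_b`
  have had' : ⟪gapDir c a, gapDir c d⟫_ℝ = 1 / 2 := by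
    rw [real_inner_comm]
    have := hc.inner_gapDir_eq hd0 ha0 hda; rwa [tightLevel_of_ne hd13 ha13] at this
  have hed' : ⟪gapDir c e, gapDir c d⟫_ℝ = 1 / 2 := by
    have := hc.inner_gapDir_eq he0 hd0 hed; rwa [tightLevel_of_ne he13 hd13] at this
  have fa := hc.inner_eq_of_tightAzimuth hb0 ha0 hd0
  have fe := hc.inner_eq_of_tightAzimuth hb0 he0 hd0
  have fae := hc.inner_eq_of_tightAzimuth hb0 ha0 he0
  rw [had', hba, ← hy] at fa
  rw [hed', hbe', ← hy] at fe
  rw [hba, hbe'] at fae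
  set α := tightAzimuth c b a - tightAzimuth c b d with hα
  set β := tightAzimuth c b e - tightAzimuth c b d with hβ
  -- `y² < 1`: `u_d ≠ ± u_b` (d ≠ b; and `u_d = −u_b` would give `⟪u_a,u_d⟫ = −1/2`)
  have hy1 : y < 1 := by
    have := hc.inner_gapDir_le hb0 hd0 hbd
    rw [tightLevel_of_ne hb13 hd13] at this; linarith
  have hy2 : -1 < y := by
    -- from `fa`: `1/2 = y/2 + √(3/4)·√(1−y²)·cos α`; if `y = −1` the right side is `−1/2`
    by_contra hle
    push Not at hle
    have habs := abs_real_inner_le_norm (gapDir c b) (gapDir c d)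
    rw [hc.norm_gapDir hb0, hc.norm_gapDir hd0, mul_one, ← hy] at habs
    have hge := neg_le_of_abs_le habs
    have hyeq : y = -1 := le_antisymm hle hge
    rw [hyeq] at fa
    norm_num at fa
  have hR : 0 < 1 - y ^ 2 := by nlinarith
  have hs3 : √(1 - (1 / 2 : ℝ) ^ 2) = √3 / 2 := sqrt_one_sub_half_sq
  rw [hs3] at fa fe fae
  have hs3sq : (√3 : ℝ) ^ 2 = 3 := Real.sq_sqrt (by norm_num)
  have hsR : (√(1 - y ^ 2)) ^ 2 = 1 - y ^ 2 := Real.sq_sqrt hR.le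
  have hsRpos : 0 < √(1 - y ^ 2) := Real.sqrt_pos.2 hR
  have hs3pos : 0 < √3 := Real.sqrt_pos.2 (by norm_num)
  -- `cos α = cos β`
  have hcos : Real.cos α = Real.cos β := by
    have h1 : √3 / 2 * √(1 - y ^ 2) * Real.cos α = √3 / 2 * √(1 - y ^ 2) * Real.cos β := by
      linarith
    exact mul_left_cancel₀ (by positivity) h1
  -- `β ≡ ± α`; the `+` sign would force `θ_e = θ_a`, i.e. `u_e = u_a`
  obtain ⟨m, hm | hm⟩ := Real.cos_eq_cos_iff.1 hcos
  · exfalso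
    -- `β = 2mπ + α` ⇒ `θ_e − θ_a = 2mπ` with both azimuths in `(−π, π]` ⇒ `m = 0`
    have hdiff : tightAzimuth c b e - tightAzimuth c b a = 2 * m * π := by
      linarith [hm, hα, hβ]
    have h1 := neg_pi_lt_tightAzimuth c b e
    have h2 := tightAzimuth_le_pi c b e
    have h3 := neg_pi_lt_tightAzimuth c b a
    have h4 := tightAzimuth_le_pi c b a
    have hm0 : m = 0 := by
      apply int_eq_zero_of_abs_lt_one
      · by_contra hge; push Not at hge
        have : (2 : ℝ) * π ≤ 2 * m * π := by nlinarith [Real.pi_pos]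
        linarith
      · by_contra hge; push Not at hge
        have : 2 * (m : ℝ) * π ≤ -(2 * π) := by nlinarith [Real.pi_pos]
        linarith
    have hdiff0 : tightAzimuth c b e - tightAzimuth c b a = 0 := by
      rw [hdiff, hm0]; simp
    have heq : tightAzimuth c b e = tightAzimuth c b a := by linarith
    rw [hc.tightAzimuth_eq hb0, hc.tightAzimuth_eq hb0] at heq
    have := eq_of_azimuth_eq (hv := hc.norm_gapDir hb0) (hc.norm_gapDir he0) (hc.norm_gapDir ha0)
      hbe' hba heq
    exact hc.gapDir_ne hD he0 ha0 (Ne.symm hae) this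
  · -- `β = 2mπ − α`: then `θ_a − θ_e = α − β = 2α − 2mπ`
    have hdiff : tightAzimuth c b a - tightAzimuth c b e = 2 * α - (m : ℝ) * (2 * π) := by
      linarith [hm, hα, hβ]
    rw [hdiff, Real.cos_sub_int_mul_two_pi, Real.cos_two_mul] at fae
    -- `cos α = (1 − y) / (√3 √(1 − y²))`, so `cos² α · 3 (1 − y²) = (1 − y)²`
    have hca : √3 * √(1 - y ^ 2) * Real.cos α = 1 - y := by linarith
    have hca2 : 3 * (1 - y ^ 2) * Real.cos α ^ 2 = (1 - y) ^ 2 := by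
      have h := congrArg (fun t => t ^ 2) hca
      simp only [mul_pow, hs3sq, hsR] at h
      linarith
    -- conclude: `x = 1/4 + (3/4)(2cos²α − 1)` and `(1 + x)(1 + y) = 1`
    have hs33 : (√3 / 2 * (√3 / 2) : ℝ) = 3 / 4 := by
      rw [div_mul_div_comm, Real.mul_self_sqrt (by norm_num)]; norm_num
    rw [hs33] at fae
    -- from hca2: 3(1-y)(1+y)·cos²α = (1-y)²  ⇒ (since 1 - y > 0) 3(1+y)cos²α = 1 - y
    have h1my : 0 < 1 - y := by linarith
    have hc2 : 3 * (1 + y) * Real.cos α ^ 2 = 1 - y := by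
      have h : (1 - y) * (3 * (1 + y) * Real.cos α ^ 2) = (1 - y) * (1 - y) := by
        linear_combination hca2
      exact mul_left_cancel₀ h1my.ne' h
    rw [fae]
    linear_combination (1 / 2 : ℝ) * hc2

/-- **R-rhomb in corner form (`cot(u_a/2)·cot(u_b/2) = 1/2`).** For the tight rhombus
`a b e d` (contacts `ab, be, ed, da`, `a ≠ e`, `b ≠ d`) the ADJACENT corners `u_a = corner c a b d`
and `u_b = corner c b a e` satisfy `(1 − cos u_a)(1 − cos u_b) = 4 (1 + cos u_a)(1 + cos u_b)`,
i.e. `tan²(u_a/2) tan²(u_b/2) = 4`, i.e. `cot(u_a/2) cot(u_b/2) = 1/2` (both corners in `(0, π)`).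
-/
theorem IsGapConfig.rhombus_corner_relation (hc : IsGapConfig c) (hD : intruderDist c < 2)
    {a b e d : Fin 14} (ha0 : a ≠ 0) (ha13 : a ≠ 13) (hb0 : b ≠ 0) (hb13 : b ≠ 13)
    (he0 : e ≠ 0) (he13 : e ≠ 13) (hd0 : d ≠ 0) (hd13 : d ≠ 13) (hae : a ≠ e) (hbd : b ≠ d)
    (hab : dist (c a) (c b) = 1) (hbe : dist (c b) (c e) = 1) (hed : dist (c e) (c d) = 1)
    (hda : dist (c d) (c a) = 1) :
    (1 - Real.cos (corner c a b d)) * (1 - Real.cos (corner c b a e)) =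
      4 * ((1 + Real.cos (corner c a b d)) * (1 + Real.cos (corner c b a e))) := by
  have hrel := hc.rhombus_diag_relation hD ha0 ha13 hb0 hb13 he0 he13 hd0 hd13 hae hbd hab hbe
    hed hda
  have hba : dist (c b) (c a) = 1 := by rw [dist_comm]; exact hab
  have had : dist (c a) (c d) = 1 := by rw [dist_comm]; exact hda
  rw [hc.cos_corner_rhombus ha0 ha13 hb0 hb13 hd0 hd13 hab had,
    hc.cos_corner_rhombus hb0 hb13 ha0 ha13 he0 he13 hba hbe]
  linear_combination (-(16 : ℝ) / 3) * hrel

end Summit.Ventures.Crystal3D
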